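import Literature.IUT.HodgeTheaters.PiAvatarBaseKitTheta
import Literature.IUT.HodgeTheaters.PiAvatarBaseKitNF
import HarnessLib

/-!
# [IUTchI] Def 6.1 (ii)–(vii) at the initial Θ-data over the NF-WIDENED transporter-or-degenerate ambient: the Θ-NF-kit
# `baseKitThetaNFOfData` (D-JΘ1-2 (iv-b′) with J-NF-1: `Amb v := ThetaAmb augGF (δ v).InPlayNF`; laws (α)(β))

S. Mochizuki, *Inter-universal Teichmüller theory I*, kurims manuscript (May 2020), Definition 6.1 (ii)–(vii) pp. 156–159, Example 6.3
(i)(ii) p. 161, Example 4.3 p. 99 (the NF-side global object `𝒟^⊚`), Example 4.4 (i)(ii) pp. 106–107. ([IUTchI] Def 6.1 (ii) p.156)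
[claim: Mochizuki2012, status: disputed] (D-0012 claim key, series status DISPUTED — kernel definitions/theorems about abc-iut's OWN kit;
nothing of the series is asserted; no side taken on [IUTchIII] Cor. 3.12).

## What this file builds

The sibling of `baseKitThetaOfData` (abc-iut-L5-t4 `PiAvatarBaseKitTheta`) over the NF-WIDENED objects in play `InPlayNF` of junction J-NF-1
(abc-iut-L5-t3 `PiAvatarLocalAmbientNF` p449994; the kit `baseKitNFOfData`, p450158): `Amb v := ThetaAmb D.augGF (δ v).InPlayNF`, so that BOTH the
`φ^NF`-side global objects (isomorphs of `𝒟^⊚`) and Example 4.4's degenerate morphisms live in one ambient — the base over which the NF kit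
(`nfKitOfData`, p451329) is re-run (file (D)) and the frozen `KitCore` is inhabited with a genuine `NFKit` (file (C)).  Every field is D13's through
the étale inclusion `ι` / transport projection `π`; laws (α) `PhiEllSync`, (β) `NegCompatModel` re-derived.  No new binder; nothing frozen edited.
typed ≠ inhabited ≠ proved; binder ≠ fact.
-/

noncomputable section

namespace Literature.IUT.HodgeTheaters

open CategoryTheory

universe u v w

section BaseKitThetaNF

variable {F : Type u} {K : Type v} {Fbar : Type w} [Field F] [NumberField F] [Field K] [NumberField K]
  [Algebra F K] [Field Fbar] [Algebra F Fbar] [Algebra K Fbar]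
  {E : WeierstrassCurve F} [E.IsElliptic] {l : ℕ} {Pb : BadPlacePredicates K}
  (D : InitialThetaData F K Fbar E l Pb) (CG : D.geom.pe.CuspGalois) (hS : D.CuspClassesNormaliserStable) [Fact l.Prime]

namespace InitialThetaData

namespace LocalDatum

variable {D CG hS} (δ : D.LocalDatum CG hS)

/-- **The NF-widened Θ-ambient at `v̲`**: the transporter-or-degenerate category on the NF-widened objects in play (isomorphs of `𝒟_v̲`, `†𝒟_v̲^±`,
`𝒟^{⊚±}`, `𝒟^⊚`). ([IUTchI] Def 6.1 (i) p.156) [claim: Mochizuki2012, status: disputed] -/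
abbrev AmbThetaNF : Type w := ThetaAmb D.augGF δ.InPlayNF

/-- The étale inclusion of the NF-widened D13 ambient. ([IUTchI] Def 6.1 (i) p.156) [claim: Mochizuki2012, status: disputed] -/
abbrev ιThetaNF : δ.AmbNF ⥤ δ.AmbThetaNF := ThetaAmb.ι D.augGF δ.InPlayNF

/-- The transport projection onto the NF-widened D13 ambient. ([IUTchI] Def 6.1 (i) p.156) [claim: Mochizuki2012, status: disputed] -/
abbrev πThetaNF : δ.AmbThetaNF ⥤ δ.AmbNF := ThetaAmb.π D.augGF δ.InPlayNF

/-- `𝒟_v̲` in the NF-widened Θ-ambient. ([IUTchI] Def 4.1 (i) p.95) [claim: Mochizuki2012, status: disputed] -/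
abbrev modelThetaNF : δ.AmbThetaNF := δ.ιThetaNF.obj δ.modelNF

/-- An object of the NF-widened Θ-ambient is an isomorph of `𝒟_v̲` iff its underlying object is.
([IUTchI] Def 4.1 (i) p.95) [claim: Mochizuki2012, status: disputed] -/
theorem nonempty_iso_modelThetaNF_iff (X : δ.AmbThetaNF) : Nonempty (X ≅ δ.modelThetaNF) ↔ Nonempty (X.toFull ≅ δ.modelNF) :=
  ThetaAmb.nonempty_iso_iff X.toFull δ.modelNF

/-- The underlying Π-ambient isomorphism of an isomorphism of the NF-widened Θ-ambient. ([IUTchI] Def 6.1 (iii) p.157) [claim: Mochizuki2012, status: disputed] -/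
abbrev isoDownNF {X Y : δ.AmbThetaNF} (φ : X ≅ Y) : X.toFull.obj ≅ Y.toFull.obj := (δ.InPlayNF).ι.mapIso (δ.πThetaNF.mapIso φ)

end LocalDatum

variable [(D.PiXund.subgroupOf D.PiXK).Normal] (hsurj : Function.Surjective D.toFlStarGlobal)
  {V : Type} [DecidableEq V] (bad arc : Finset V) (δ : V → D.LocalDatum CG hS)

/-- **THE GENUINE Θ-NF-KIT OF [IUTchI] §6 AT THE INITIAL Θ-DATA** (Π-avatar, design D1 EMBEDDED, J-NF-1 widened, bad-place repair (iv-b′)): the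
interface `PMBaseKit l` filled exactly as `baseKitNFOfData` but over `ThetaAmb augGF (δ v).InPlayNF` at every index; `labOfHom` reads the transport
datum. Binders: those of `baseKitNFOfData`, none added. ([IUTchI] Def 6.1 (ii)-(vii) pp.156-159) [claim: Mochizuki2012, status: disputed] -/
def baseKitThetaNFOfData : PMBaseKit.{w} l where
  V := V
  bad := bad
  arc := arc
  Amb v := (δ v).AmbThetaNF
  model v := (δ v).modelThetaNF
  pmObj v X := (δ v).ιThetaNF.obj ((δ v).pmPairNF X.toFull).1
  toPM v X := (δ v).ιThetaNF.map ((δ v).pmPairNF X.toFull).2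
  LabCuspPM _ _ := D.geom.pe.Cusp
  labPM _ _ _ := D.gLabPMModel CG
  labMap := fun v {X} {Y} φ => (δ v).labMapAmb ((δ v).isoDownNF φ)
  labMap_refl v X := by
    change (δ v).labMapAmb (((δ v).InPlayNF).ι.mapIso ((δ v).πThetaNF.mapIso (Iso.refl X))) = _
    rw [Functor.mapIso_refl, Functor.mapIso_refl]
    exact (δ v).labMapAmb_refl _
  labMap_trans := fun v {X} {Y} {Z} φ ψ => by
    change (δ v).labMapAmb (((δ v).InPlayNF).ι.mapIso ((δ v).πThetaNF.mapIso (φ ≪≫ ψ))) = _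
    rw [Functor.mapIso_trans, Functor.mapIso_trans]
    exact (δ v).labMapAmb_trans _ _
  labMap_charts := fun v {X} {Y} hX _ φ e he =>
    (δ v).labMapAmb_trans_mem_charts ⟨(δ v).isoDownNF hX.some⟩ _ he
  exists_negative v X hX := by
    obtain ⟨α₀, hα₀⟩ := (δ v).exists_labMapAmb_ne_refl (X := X.toFull.obj) ⟨(δ v).isoDownNF hX.some⟩
    refine ⟨(δ v).ιThetaNF.mapIso (((δ v).InPlayNF).isoMk (X := X.toFull) (Y := X.toFull) α₀), ?_⟩
    have h : (δ v).isoDownNF ((δ v).ιThetaNF.mapIso (((δ v).InPlayNF).isoMk (X := X.toFull) (Y := X.toFull) α₀)) = α₀ :=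
      Iso.ext rfl
    change (δ v).labMapAmb ((δ v).isoDownNF ((δ v).ιThetaNF.mapIso (((δ v).InPlayNF).isoMk (X := X.toFull) (Y := X.toFull) α₀))) ≠ _
    rw [h]
    exact hα₀
  Glob := D.Glob
  gModel := D.gModel
  gIso := D.gIso
  GLab := D.GLabOf
  gLabMap := fun {G} {H} φ => D.gLabIso CG hS φ
  gLabMap_refl := D.gLabIso_refl CG hS
  gLabMap_trans := fun {G} {H} {J} φ ψ => D.gLabIso_trans CG hS φ ψ
  toFlStar := D.toFlStarOf
  toFlStar_surjective := D.toFlStarOf_surjective_of hsurj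
  gLabT := D.gLabTModel CG
  gChart₀ := D.gChart₀Model CG
  gChart₀_mem := D.gChart₀Model_mem_charts CG
  autCsp_le := D.autCsp_le_of CG hS
  gLab_range := D.gLab_range_of CG hS
  atV v := (δ v).atVNF ⋙ (δ v).ιThetaNF
  phiEll v := (δ v).ιThetaNF.map (δ v).phiEllNF
  labOfHom := fun v {X} {G} f => (δ v).labOfHomAmb (G := G) ((δ v).πThetaNF.map f).hom
  labOfHom_pre := fun v {X} {Y} {G} φ f => (δ v).labOfHomAmb_pre ((δ v).isoDownNF φ) ((δ v).πThetaNF.map f).hom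
  labOfHom_post := fun v {X} {G} {H} f ψ => (δ v).labOfHomAmb_post_of_inPlayNF X.toFull.property ((δ v).πThetaNF.map f).hom ψ
  labOfHom_phiEll_bijective v := by
    change Function.Bijective ((δ v).labOfHomAmb (G := D.gModel) (δ v).phiEllAmb)
    rw [(δ v).labOfHomAmb_phiEllAmb]
    exact Function.bijective_id
  labOfHom_phiEll_charts v e he := by
    have key : ∀ (g : D.geom.pe.Cusp → D.geom.pe.Cusp) (hb : Function.Bijective g), g = id →
        (Equiv.ofBijective g hb).symm.trans e = e := by
      rintro g hb rfl
      ext x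
      change e ((Equiv.ofBijective id hb).symm x) = e x
      congr 1
      exact Equiv.ofBijective_apply_symm_apply id hb x
    have hmem : e ∈ (D.gLabTModel CG).charts := (D.gLabPMModel CG).mem_toTorsor_charts he
    convert hmem using 1
    exact key _ _ ((δ v).labOfHomAmb_phiEllAmb)

/-! ### Definitional readings -/

/-- The index type of the Θ-NF-kit (definitional). ([IUTchI] Def 3.1 (e) p.62) [claim: Mochizuki2012, status: disputed] -/
@[simp] theorem baseKitThetaNFOfData_V : (D.baseKitThetaNFOfData CG hS hsurj bad arc δ).V = V := rfl

/-- The bad indices of the Θ-NF-kit (definitional). ([IUTchI] Def 3.1 (e) p.62) [claim: Mochizuki2012, status: disputed] -/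
@[simp] theorem baseKitThetaNFOfData_bad : (D.baseKitThetaNFOfData CG hS hsurj bad arc δ).bad = bad := rfl

/-- The archimedean indices of the Θ-NF-kit (definitional). ([IUTchI] Def 3.1 (e) p.62) [claim: Mochizuki2012, status: disputed] -/
@[simp] theorem baseKitThetaNFOfData_arc : (D.baseKitThetaNFOfData CG hS hsurj bad arc δ).arc = arc := rfl

/-- The ambient of the Θ-NF-kit at `v` (definitional). ([IUTchI] Def 6.1 (i) p.156) [claim: Mochizuki2012, status: disputed] -/
theorem baseKitThetaNFOfData_Amb (v : V) : (D.baseKitThetaNFOfData CG hS hsurj bad arc δ).Amb v = (δ v).AmbThetaNF := rfl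

/-- The model of the Θ-NF-kit at `v` is `ι(𝒟_v̲)` (definitional). ([IUTchI] Def 4.1 (i) p.95) [claim: Mochizuki2012, status: disputed] -/
theorem baseKitThetaNFOfData_model (v : V) : (D.baseKitThetaNFOfData CG hS hsurj bad arc δ).model v = (δ v).modelThetaNF := rfl

/-- The underlying Π-ambient object of the model is `ℬ(Π_v̲)⁰` (definitional). ([IUTchI] Def 4.1 (i) p.95) [claim: Mochizuki2012, status: disputed] -/
theorem baseKitThetaNFOfData_model_obj (v : V) : ((D.baseKitThetaNFOfData CG hS hsurj bad arc δ).model v).toFull.obj = (δ v).locObj := rfl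

/-- `φ^{Θell}_{•,v̲}` of the Θ-NF-kit is `ι(φ^{Θell}_{•,v̲})` (definitional). ([IUTchI] Ex 6.3 (i) p.161) [claim: Mochizuki2012, status: disputed] -/
theorem baseKitThetaNFOfData_phiEll (v : V) :
    (D.baseKitThetaNFOfData CG hS hsurj bad arc δ).phiEll v = (δ v).ιThetaNF.map (δ v).phiEllNF := rfl

/-- The label map of a morphism of the Θ-NF-kit is that of its transport datum (definitional).
([IUTchI] Prop 6.5 (i) p.163) [claim: Mochizuki2012, status: disputed] -/
theorem baseKitThetaNFOfData_labOfHom (v : V) {X : (δ v).AmbThetaNF} {G : D.Glob} (f : X ⟶ ((δ v).atVNF ⋙ (δ v).ιThetaNF).obj G) :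
    (D.baseKitThetaNFOfData CG hS hsurj bad arc δ).labOfHom v f = (δ v).labOfHomAmb (G := G) ((δ v).πThetaNF.map f).hom := rfl

/-- The label map of an isomorphism of the Θ-NF-kit is that of its underlying Π-ambient isomorphism (definitional).
([IUTchI] Def 6.1 (iii) p.157) [claim: Mochizuki2012, status: disputed] -/
theorem baseKitThetaNFOfData_labMap (v : V) {X Y : (δ v).AmbThetaNF} (φ : X ≅ Y) :
    (D.baseKitThetaNFOfData CG hS hsurj bad arc δ).labMap v φ = (δ v).labMapAmb ((δ v).isoDownNF φ) := rfl

/-- **(O1) by tag** at the Θ-NF-kit: a NON-invertible endomorphism of `𝒟_v̲` from any degenerate outer endomorphism of `Π_v̲` (abc-iut-w4-d054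
p456090's necessary condition; «¬ IsIso» here is by tag, not a statement about the outer homomorphism). ([IUTchI] Ex 4.4 (i) p.106) [claim: Mochizuki2012, status: disputed] -/
theorem exists_endo_not_isIso_baseKitThetaNFOfData (v : V) (φ : OuterHom (δ v).H (δ v).H) (hφ : φ.IsDegOver D.augGF) :
    ∃ f : (D.baseKitThetaNFOfData CG hS hsurj bad arc δ).model v ⟶ (D.baseKitThetaNFOfData CG hS hsurj bad arc δ).model v, ¬ IsIso f :=
  ThetaAmb.exists_endo_not_isIso (aug := D.augGF) (δ v).modelNF φ hφ

/-! ### (α) `PhiEllSync` and (β) `NegCompatModel` at the Θ-NF-kit -/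

/-- In the Θ-NF-kit, pulling a chart of `𝒟_v̲` back along the (identity) label map of `φ^{Θell}_{•,v̲}` returns the chart.
([IUTchI] Ex 6.3 (i) p.161) [claim: Mochizuki2012, status: disputed] -/
theorem ofBijective_labOfHom_phiEll_symm_trans_thetaNF (v : V) (e : D.geom.pe.Cusp ≃ ZMod l) :
    (Equiv.ofBijective _ ((D.baseKitThetaNFOfData CG hS hsurj bad arc δ).labOfHom_phiEll_bijective v)).symm.trans e = e := by
  have key : ∀ (g : D.geom.pe.Cusp → D.geom.pe.Cusp) (hb : Function.Bijective g), g = id →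
      (Equiv.ofBijective g hb).symm.trans e = e := by
    rintro g hb rfl
    ext x
    change e ((Equiv.ofBijective id hb).symm x) = e x
    congr 1
    exact Equiv.ofBijective_apply_symm_apply id hb x
  exact key _ _ ((δ v).labOfHomAmb_phiEllAmb)

/-- **(α) `PhiEllSync` HOLDS at the Θ-NF-kit.** ([IUTchI] Ex 6.3 (i) p.161) [claim: Mochizuki2012, status: disputed] -/
theorem phiEllSync_baseKitThetaNFOfData : PMBaseKit.Ex63.PhiEllSync (D.baseKitThetaNFOfData CG hS hsurj bad arc δ) := by
  intro v e he
  obtain ⟨ε, hε⟩ := (CG.mem_labPM_charts_iff D.geom.PiXbar_relIndex e).mp he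
  exact ⟨ε, by rw [D.ofBijective_labOfHom_phiEll_symm_trans_thetaNF CG hS hsurj bad arc δ v e, hε]; rfl⟩

/-- **(β) `NegCompatModel` HOLDS at the Θ-NF-kit**: the J-NF-1 negative square transported by `ι`. ([IUTchI] Ex 6.3 (ii) p.161) [claim: Mochizuki2012, status: disputed] -/
theorem negCompatModel_baseKitThetaNFOfData : PMBaseKit.Ex63.NegCompatModel (D.baseKitThetaNFOfData CG hS hsurj bad arc δ) := by
  refine fun (v : V) => ?_
  obtain ⟨a, ha, b, hb, hsq⟩ := D.negCompatModel_baseKitNFOfData CG hS hsurj bad arc δ v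
  refine ⟨(δ v).ιThetaNF.mapIso a, ?_, b, hb, ?_⟩
  · have h : (δ v).isoDownNF ((δ v).ιThetaNF.mapIso a) = ((δ v).InPlayNF).ι.mapIso a := Iso.ext rfl
    change (δ v).labMapAmb ((δ v).isoDownNF ((δ v).ιThetaNF.mapIso a)) = _
    rw [h]
    exact ha
  · change (δ v).ιThetaNF.map a.hom ≫ (δ v).ιThetaNF.map (δ v).phiEllNF =
      (δ v).ιThetaNF.map (δ v).phiEllNF ≫ (δ v).ιThetaNF.map ((δ v).atVNF.map b.hom)
    rw [← Functor.map_comp, ← Functor.map_comp]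
    exact congrArg _ hsq

end InitialThetaData

end BaseKitThetaNF

end Literature.IUT.HodgeTheaters
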